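import Summits.AtomisticToContinuum.Crystallization.Theorems.SquareWellLayerCakeGapTwelveToBarlowUniformSpacingSelectionLimit
import Summits.AtomisticToContinuum.Crystallization.Theorems.SquareWellLayerCakeGapTwelveToBarlowUniformSpacingTransfer
import Summits.AtomisticToContinuum.Crystallization.Theorems.SquareWellLayerCakeGapTwelveToBarlowUniformSpacingSelectionDensity
import Summits.AtomisticToContinuum.Crystallization.Theorems.SquareWellLayerCakeGapTwelveToBarlowUniformSpacingSelectionCount

/-!
# `stub_uniformSpacingSelection` (crux `GapTwelveToBarlow`, stmt-AtomisticToContinuum-15807) — PROVED: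
# bridge III (assembly from (b1) finite-`N` windows and the hull bad-layer bound) and the final composition

`hullBadLayers_to_ae_of_windows` (bridge III): the registered statement of
`stub_uniformSpacingSelection` (a.e. near-uniform gaps of relaxed-layered windows) follows from

* **(b1) `windows_of_badDensity`** (hypothesis `hwin`; proved as `stub_windowsOfBadDensity` in
  `UniformSpacingSelectionDensity`, typed in `SIGB1_windows_of_badDensity.txt`): if the density of sites that are not near-uniformly
  relaxed-matched at `(R, ε, δ)` does not tend to `0`, then for every count `c` there is a window
  length `L` such that at every scale `n` and tolerance `ε₁`, frequently in `N`, some normalised layered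
  window of `x N` has `≥ c` base layers in `[−L, L]` that are bad at precision `δ` and range `⌈2R⌉₊`
  (finite-`N` double counting over all-Good relaxed-matched centres, rebasing, per-layer counting,
  sub-block averaging, re-centring);
* **the hull bad-layer bound** (hypothesis `hhull` = statement of `stub_hullBadLayers`, energetic part (a),
  proved in `UniformSpacingSelectionCount`),

by contradiction: with `B₀ = B₀(δ/2, ⌈2R⌉₊)` and `c = ⌊B₀⌋₊ + 1`, `hull_badLayers_of_windows` (bridge II)
turns the windows of (b1) into a layered hull element with `≥ c > B₀` base layers in `[−L, L]` that are
bad at precision `δ/2`, contradicting the hull bound on the block `[−L, L]`.  Hence, at the end of this file,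
`stub_uniformSpacingSelection = hullBadLayers_to_ae_of_windows stub_windowsOfBadDensity stub_hullBadLayers`
(the registered signature verbatim; formerly split as `…Bridge` + `…Final`, merged because the bridge
statement exceeds the anchor length limit).
-/

noncomputable section

namespace Summit.AtomisticToContinuum.Crystallization.Theorems.SquareWellLayerCakeGapTwelveToBarlow

open scoped BigOperators
open Filter Topology Literature.MathematicalPhysics.StatisticalMechanics
open Summit.AtomisticToContinuum.Crystallization.Theorems.LayeredHull

/-- **The selection stub from (b1) and the hull bound.**  See the module docstring. [folklore] -/
theorem hullBadLayers_to_ae_of_windows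
    (hwin : ∀ x : (N : ℕ) → (Fin N → EuclideanSpace ℝ (Fin 3)),
        (∀ D : ℝ, 0 < D →
                Filter.Tendsto (fun N : ℕ => (Nat.card {i : Fin N // ¬ (∀ j : Fin N, dist (x N i) (x N j) ≤ D →
                  ((∀ j' : Fin N, dist (x N j) (x N j') ≤ 11 / 10 → ∀ k : Fin N, k ≠ j' → (55 : ℝ) / 57 ≤ dist (x N j') (x N k)) ∧
                  (Finset.univ.filter fun j' : Fin N => j' ≠ j ∧ dist (x N j) (x N j') ≤ 1).card = 12 ∧
                  (Finset.univ.filter fun j' : Fin N => j' ≠ j ∧ dist (x N j) (x N j') ≤ 11 / 10).card ≤ 12))} : ℝ) / N)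
                  Filter.atTop (nhds 0)) →
        (∀ R ε : ℝ, 0 < R → 0 < ε → ε < 1 / 4 →
                Filter.Tendsto (fun N : ℕ => (Nat.card {i : Fin N // ¬ (∃ a : ℝ, 47 / 50 ≤ a ∧ a ≤ 1 ∧
                  ∃ s : ℤ → ℤ, IsHaggSeq s ∧ ∃ z : ℤ → ℝ,
                    (∀ m : ℤ, 39 / 50 * a ≤ z (m + 1) - z m ∧ z (m + 1) - z m ≤ 17 / 20 * a) ∧
                    ∃ m₀ i₀ j₀ : ℤ, ∃ A : EuclideanSpace ℝ (Fin 3) →ₗᵢ[ℝ] EuclideanSpace ℝ (Fin 3),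
                      (∀ m i' j' : ℤ, dist (layeredPos a s z m i' j') (layeredPos a s z m₀ i₀ j₀) ≤ R →
                        ∃ j : Fin N, dist (x N j) (x N i + A (layeredPos a s z m i' j' - layeredPos a s z m₀ i₀ j₀)) ≤ ε) ∧
                      (∀ j : Fin N, dist (x N j) (x N i) ≤ R → ∃ m i' j' : ℤ,
                        dist (x N j) (x N i + A (layeredPos a s z m i' j' - layeredPos a s z m₀ i₀ j₀)) ≤ ε))} : ℝ) / N)
                  Filter.atTop (nhds 0)) →
        ∀ R ε δ : ℝ, 0 < R → 0 < ε → 0 < δ →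
        ¬ Filter.Tendsto (fun N : ℕ => (Nat.card {i : Fin N // ¬ (∃ a : ℝ, 47 / 50 ≤ a ∧ a ≤ 1 ∧
                    ∃ s : ℤ → ℤ, IsHaggSeq s ∧ ∃ z : ℤ → ℝ,
                      (∀ m : ℤ, 39 / 50 * a ≤ z (m + 1) - z m ∧ z (m + 1) - z m ≤ 17 / 20 * a) ∧
                      ∃ m₀ i₀ j₀ : ℤ, ∃ A : EuclideanSpace ℝ (Fin 3) →ₗᵢ[ℝ] EuclideanSpace ℝ (Fin 3),
                        (∃ h : ℝ, ∀ m : ℤ, |(m : ℝ) - m₀| ≤ 2 * R → |z m - z m₀ - ((m : ℝ) - m₀) * h| ≤ δ) ∧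
                        (∀ m i' j' : ℤ, dist (layeredPos a s z m i' j') (layeredPos a s z m₀ i₀ j₀) ≤ R →
                          ∃ j : Fin N, dist (x N j) (x N i + A (layeredPos a s z m i' j' - layeredPos a s z m₀ i₀ j₀)) ≤ ε) ∧
                        (∀ j : Fin N, dist (x N j) (x N i) ≤ R → ∃ m i' j' : ℤ,
                          dist (x N j) (x N i + A (layeredPos a s z m i' j' - layeredPos a s z m₀ i₀ j₀)) ≤ ε))} : ℝ) / N)
                    Filter.atTop (nhds 0) →
      ∀ c : ℕ, ∃ L : ℕ, ∀ (n : ℕ) (ε₁ : ℝ), 0 < ε₁ → ∃ᶠ N in Filter.atTop,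
        ∃ (t : EuclideanSpace ℝ (Fin 3)) (A : EuclideanSpace ℝ (Fin 3) →ₗᵢ[ℝ] EuclideanSpace ℝ (Fin 3))
          (a : ℝ) (s : ℤ → ℤ) (z : ℤ → ℝ),
          47 / 50 ≤ a ∧ a ≤ 1 ∧ IsHaggSeq s ∧
          (∀ m : ℤ, 39 / 50 * a ≤ z (m + 1) - z m ∧ z (m + 1) - z m ≤ 17 / 20 * a) ∧
          (-(17 / 20 * a) ≤ z 0 ∧ z 0 ≤ 0) ∧
          (let S : Set (EuclideanSpace ℝ (Fin 3)) := {p | ∃ m i j : ℤ, p = A (((i : ℝ) • triangularVec₁ a) +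
            ((j : ℝ) • triangularVec₂ a) + ((haggLabel s m : ℝ) • barlowOffset a) + (z m • layerNormal 1))};
            (∀ p ∈ S, ‖p‖ ≤ n → ∃ i : Fin N, dist (x N i + t) p ≤ ε₁) ∧
            (∀ i : Fin N, ‖x N i + t‖ ≤ n → ∃ p ∈ S, dist (x N i + t) p ≤ ε₁)) ∧
          ∃ B : Finset ℤ, B ⊆ Finset.Icc (-(L : ℤ)) L ∧ c ≤ B.card ∧
            ∀ m₀ ∈ B, ¬ ∃ h : ℝ, ∀ m : ℤ, |(m : ℝ) - m₀| ≤ (⌈2 * R⌉₊ : ℕ) →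
              |z m - z m₀ - ((m : ℝ) - m₀) * h| ≤ δ)
    (hhull : ∀ (δ : ℝ), 0 < δ → ∀ (K : ℕ), ∃ B₀ : ℝ,
        ∀ (x : (N : ℕ) → (Fin N → (EuclideanSpace ℝ (Fin 3)))), (∀ N, IsGroundState lennardJones (x N)) →
        ∀ (a : ℝ), 47 / 50 ≤ a → a ≤ 1 →
        ∀ (A : (EuclideanSpace ℝ (Fin 3)) →ₗᵢ[ℝ] (EuclideanSpace ℝ (Fin 3))) (s : ℤ → ℤ) (z : ℤ → ℝ),
        IsHaggSeq s → (∀ m : ℤ, 39 / 50 * a ≤ z (m + 1) - z m ∧ z (m + 1) - z m ≤ 17 / 20 * a) →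
        (let S : Set (EuclideanSpace ℝ (Fin 3)) := {p | ∃ m i j : ℤ, p = A (((i : ℝ) • triangularVec₁ a) +
            ((j : ℝ) • triangularVec₂ a) + ((haggLabel s m : ℝ) • barlowOffset a) + (z m • layerNormal 1))};
          ∀ R ε : ℝ, 0 < ε → ∃ᶠ N in atTop, ∃ t : (EuclideanSpace ℝ (Fin 3)),
            (∀ p ∈ S, ‖p‖ ≤ R → ∃ i : Fin N, dist (x N i + t) p ≤ ε) ∧
            (∀ i : Fin N, ‖x N i + t‖ ≤ R → ∃ p ∈ S, dist (x N i + t) p ≤ ε)) →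
        ∀ (m₁ : ℤ) (n : ℕ) (B : Finset ℤ), B ⊆ Finset.Ico m₁ (m₁ + n) →
          (∀ m₀ ∈ B, ¬ ∃ h : ℝ, ∀ m : ℤ, |(m : ℝ) - m₀| ≤ K → |z m - z m₀ - ((m : ℝ) - m₀) * h| ≤ δ) →
          (B.card : ℝ) ≤ B₀ ) :
    ∀ x : (N : ℕ) → (Fin N → EuclideanSpace ℝ (Fin 3)),
      (∀ N, IsGroundState lennardJones (x N)) →
      (∀ D : ℝ, 0 < D →
        Filter.Tendsto (fun N : ℕ => (Nat.card {i : Fin N // ¬ (∀ j : Fin N, dist (x N i) (x N j) ≤ D →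
          ((∀ j' : Fin N, dist (x N j) (x N j') ≤ 11 / 10 → ∀ k : Fin N, k ≠ j' → (55 : ℝ) / 57 ≤ dist (x N j') (x N k)) ∧
          (Finset.univ.filter fun j' : Fin N => j' ≠ j ∧ dist (x N j) (x N j') ≤ 1).card = 12 ∧
          (Finset.univ.filter fun j' : Fin N => j' ≠ j ∧ dist (x N j) (x N j') ≤ 11 / 10).card ≤ 12))} : ℝ) / N)
          Filter.atTop (nhds 0)) →
      (∀ R ε : ℝ, 0 < R → 0 < ε → ε < 1 / 4 →
        Filter.Tendsto (fun N : ℕ => (Nat.card {i : Fin N // ¬ (∃ a : ℝ, 47 / 50 ≤ a ∧ a ≤ 1 ∧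
          ∃ s : ℤ → ℤ, IsHaggSeq s ∧ ∃ z : ℤ → ℝ,
            (∀ m : ℤ, 39 / 50 * a ≤ z (m + 1) - z m ∧ z (m + 1) - z m ≤ 17 / 20 * a) ∧
            ∃ m₀ i₀ j₀ : ℤ, ∃ A : EuclideanSpace ℝ (Fin 3) →ₗᵢ[ℝ] EuclideanSpace ℝ (Fin 3),
              (∀ m i' j' : ℤ, dist (layeredPos a s z m i' j') (layeredPos a s z m₀ i₀ j₀) ≤ R →
                ∃ j : Fin N, dist (x N j) (x N i + A (layeredPos a s z m i' j' - layeredPos a s z m₀ i₀ j₀)) ≤ ε) ∧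
              (∀ j : Fin N, dist (x N j) (x N i) ≤ R → ∃ m i' j' : ℤ,
                dist (x N j) (x N i + A (layeredPos a s z m i' j' - layeredPos a s z m₀ i₀ j₀)) ≤ ε))} : ℝ) / N)
          Filter.atTop (nhds 0)) →
      ∀ R ε δ : ℝ, 0 < R → 0 < ε → 0 < δ →
        Filter.Tendsto (fun N : ℕ => (Nat.card {i : Fin N // ¬ (∃ a : ℝ, 47 / 50 ≤ a ∧ a ≤ 1 ∧
          ∃ s : ℤ → ℤ, IsHaggSeq s ∧ ∃ z : ℤ → ℝ,
            (∀ m : ℤ, 39 / 50 * a ≤ z (m + 1) - z m ∧ z (m + 1) - z m ≤ 17 / 20 * a) ∧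
            ∃ m₀ i₀ j₀ : ℤ, ∃ A : EuclideanSpace ℝ (Fin 3) →ₗᵢ[ℝ] EuclideanSpace ℝ (Fin 3),
              (∃ h : ℝ, ∀ m : ℤ, |(m : ℝ) - m₀| ≤ 2 * R → |z m - z m₀ - ((m : ℝ) - m₀) * h| ≤ δ) ∧
              (∀ m i' j' : ℤ, dist (layeredPos a s z m i' j') (layeredPos a s z m₀ i₀ j₀) ≤ R →
                ∃ j : Fin N, dist (x N j) (x N i + A (layeredPos a s z m i' j' - layeredPos a s z m₀ i₀ j₀)) ≤ ε) ∧
              (∀ j : Fin N, dist (x N j) (x N i) ≤ R → ∃ m i' j' : ℤ,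
                dist (x N j) (x N i + A (layeredPos a s z m i' j' - layeredPos a s z m₀ i₀ j₀)) ≤ ε))} : ℝ) / N)
          Filter.atTop (nhds 0) := by
  intro x hx hG hRM R ε δ hR hε hδ
  by_contra hnot
  obtain ⟨B₀, hB₀⟩ := hhull (δ / 2) (by positivity) ⌈2 * R⌉₊
  obtain ⟨L, hL⟩ := hwin x hG hRM R ε δ hR hε hδ hnot (⌊B₀⌋₊ + 1)
  obtain ⟨A₀, a₀, s₀, z₀, ha₀, ha₀1, hs₀, hz₀, hH, B, hBsub, hBcard, hBbad⟩ :=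
    hull_badLayers_of_windows x L ⌈2 * R⌉₊ (⌊B₀⌋₊ + 1) δ hδ hL
  have hsub : B ⊆ Finset.Ico (-(L : ℤ)) (-(L : ℤ) + ((2 * L + 1 : ℕ) : ℤ)) := by
    intro m hm
    have := Finset.mem_Icc.1 (hBsub hm)
    rw [Finset.mem_Ico]
    push_cast
    omega
  have hbound := hB₀ x hx a₀ ha₀ ha₀1 A₀ s₀ z₀ hs₀ hz₀ hH (-(L : ℤ)) (2 * L + 1) B hsub hBbad
  have h1 : (((⌊B₀⌋₊ + 1 : ℕ) : ℕ) : ℝ) ≤ B.card := by exact_mod_cast hBcard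
  have h2 := Nat.lt_floor_add_one B₀
  push_cast at h1
  linarith

/-- **`stub_uniformSpacingSelection` (registered signature, skeleton v3 of crux
stmt-AtomisticToContinuum-15807): a.e. near-uniform interlayer gaps of the relaxed-layered windows of
Lennard-Jones ground states.** [folklore] -/
theorem stub_uniformSpacingSelection :
    ∀ x : (N : ℕ) → (Fin N → EuclideanSpace ℝ (Fin 3)),
      (∀ N, IsGroundState lennardJones (x N)) →
      (∀ D : ℝ, 0 < D →
        Filter.Tendsto (fun N : ℕ => (Nat.card {i : Fin N // ¬ (∀ j : Fin N, dist (x N i) (x N j) ≤ D →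
          ((∀ j' : Fin N, dist (x N j) (x N j') ≤ 11 / 10 → ∀ k : Fin N, k ≠ j' → (55 : ℝ) / 57 ≤ dist (x N j') (x N k)) ∧
          (Finset.univ.filter fun j' : Fin N => j' ≠ j ∧ dist (x N j) (x N j') ≤ 1).card = 12 ∧
          (Finset.univ.filter fun j' : Fin N => j' ≠ j ∧ dist (x N j) (x N j') ≤ 11 / 10).card ≤ 12))} : ℝ) / N)
          Filter.atTop (nhds 0)) →
      (∀ R ε : ℝ, 0 < R → 0 < ε → ε < 1 / 4 →
        Filter.Tendsto (fun N : ℕ => (Nat.card {i : Fin N // ¬ (∃ a : ℝ, 47 / 50 ≤ a ∧ a ≤ 1 ∧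
          ∃ s : ℤ → ℤ, IsHaggSeq s ∧ ∃ z : ℤ → ℝ,
            (∀ m : ℤ, 39 / 50 * a ≤ z (m + 1) - z m ∧ z (m + 1) - z m ≤ 17 / 20 * a) ∧
            ∃ m₀ i₀ j₀ : ℤ, ∃ A : EuclideanSpace ℝ (Fin 3) →ₗᵢ[ℝ] EuclideanSpace ℝ (Fin 3),
              (∀ m i' j' : ℤ, dist (layeredPos a s z m i' j') (layeredPos a s z m₀ i₀ j₀) ≤ R →
                ∃ j : Fin N, dist (x N j) (x N i + A (layeredPos a s z m i' j' - layeredPos a s z m₀ i₀ j₀)) ≤ ε) ∧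
              (∀ j : Fin N, dist (x N j) (x N i) ≤ R → ∃ m i' j' : ℤ,
                dist (x N j) (x N i + A (layeredPos a s z m i' j' - layeredPos a s z m₀ i₀ j₀)) ≤ ε))} : ℝ) / N)
          Filter.atTop (nhds 0)) →
      ∀ R ε δ : ℝ, 0 < R → 0 < ε → 0 < δ →
        Filter.Tendsto (fun N : ℕ => (Nat.card {i : Fin N // ¬ (∃ a : ℝ, 47 / 50 ≤ a ∧ a ≤ 1 ∧
          ∃ s : ℤ → ℤ, IsHaggSeq s ∧ ∃ z : ℤ → ℝ,
            (∀ m : ℤ, 39 / 50 * a ≤ z (m + 1) - z m ∧ z (m + 1) - z m ≤ 17 / 20 * a) ∧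
            ∃ m₀ i₀ j₀ : ℤ, ∃ A : EuclideanSpace ℝ (Fin 3) →ₗᵢ[ℝ] EuclideanSpace ℝ (Fin 3),
              (∃ h : ℝ, ∀ m : ℤ, |(m : ℝ) - m₀| ≤ 2 * R → |z m - z m₀ - ((m : ℝ) - m₀) * h| ≤ δ) ∧
              (∀ m i' j' : ℤ, dist (layeredPos a s z m i' j') (layeredPos a s z m₀ i₀ j₀) ≤ R →
                ∃ j : Fin N, dist (x N j) (x N i + A (layeredPos a s z m i' j' - layeredPos a s z m₀ i₀ j₀)) ≤ ε) ∧
              (∀ j : Fin N, dist (x N j) (x N i) ≤ R → ∃ m i' j' : ℤ,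
                dist (x N j) (x N i + A (layeredPos a s z m i' j' - layeredPos a s z m₀ i₀ j₀)) ≤ ε))} : ℝ) / N)
          Filter.atTop (nhds 0) :=
  hullBadLayers_to_ae_of_windows stub_windowsOfBadDensity stub_hullBadLayers

end Summit.AtomisticToContinuum.Crystallization.Theorems.SquareWellLayerCakeGapTwelveToBarlow

end
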